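import Mathlib
import HarnessLib
import Summits.Ventures.LatticeQCDFlow.Scaling.U1WilsonIdentityFlowLaw
import Summits.Ventures.LatticeQCDFlow.Scaling.AcceptanceEssEightNinthsStrict

/-!
# LatticeQCDFlow / Scaling — the untrained U(1) Wilson sampler in box coordinates: the
# `(8/9)·ESS` floor is STRICT on every finite complex and on the periodic torus

HONEST FRAMING: exact (Metropolis-corrected) sampling algorithms for lattice gauge theory;
figures of merit are autocorrelation/cost numbers at stated couplings and volumes; no
continuum-physics claim.

Venture `LatticeQCDFlow` (cell pub-lqcd), topic `Scaling`; FANOUT row 3 (`s0-u1-a`, S0-B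
implementation A, GEN-14).  NEW WORK of the cell (elementary): row 3's strict floor for weights
bounded below (`Scaling/AcceptanceEssEightNinthsStrict`, imported) applied to row 3's box-coordinate
untrained U(1) Wilson sampler (`Scaling/U1WilsonIdentityFlowLaw`, imported: any finite complex `Ps`,
incidences `inc`, couplings `βp`, weight `W(θ) = exp(Σ_p β_p cos θ_p)` on `(0, 2π]^{n+1}` against the
Haar density `(2π)^{−(n+1)}`; the periodic `L₁ × L₂` torus at uniform coupling via row 5's
`torus_u1WilsonZ_uniform`).  NO definition is introduced.

* `u1WilsonWeight_ge` — `W(θ) ≥ exp(−Σ_p |β_p|)`: the importance ratio `W·(2π)^{n+1}` of the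
  untrained sampler is bounded below by a positive constant;
* **`u1WilsonIdentityFlow_meanAccept_gt`** — for EVERY coupling family,
  `(8/9)·Z(β)²/((2π)^{n+1} Z(2β)) < acc` STRICTLY (GEN-13's sandwich, floor side);
* **`u1TorusIdentityFlow_meanAccept_gt`** — on the torus,
  `(8/9)·(Σₖ I_{|k|}(β)^V)²/Σₖ I_{|k|}(2β)^V < acc` for every `β` and `V = L₁L₂`.

Reading (value-free): the zero-training row of the S0-B board accepts strictly more often than `8/9`
of its effective sample size, at every coupling and volume, also in the box-coordinate torus
description of row 5.  NOT CLAIMED: strictness of the Bhattacharyya CEILING in box coordinates (done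
for theory-2's Haar-measure formulation in `Scaling/WilsonActionNontrivial`, `L ≥ 2`); any
acceptance VALUE of ours; nothing re-scored.
-/

noncomputable section

namespace Summit.Ventures.LatticeQCDFlow.Theory2

open MeasureTheory Real Set Finset
open Literature.Analysis.FunctionSpaces (besselI)
open Summit.Ventures.LatticeQCDFlow.Scoring

/-! ## Any finite complex -/

section General

variable {n : ℕ} {ι : Type*} (Ps : Finset ι) (inc : ι → Fin (n + 1) → ℤ) (βp : ι → ℝ)

/-- **The Wilson weight is bounded below**: `exp(Σ_p β_p cos θ_p) ≥ exp(−Σ_p |β_p|)`. [folklore] -/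
theorem u1WilsonWeight_ge (θ : Fin (n + 1) → ℝ) :
    Real.exp (-∑ p ∈ Ps, |βp p|) ≤ u1WilsonWeight Ps inc βp θ := by
  unfold u1WilsonWeight
  refine Real.exp_le_exp.2 ?_
  rw [← sum_neg_distrib]
  refine sum_le_sum fun p _ => ?_
  have h1 := Real.abs_cos_le_one (u1PlaqAngle inc p θ)
  have h2 : |βp p * Real.cos (u1PlaqAngle inc p θ)| ≤ |βp p| := by
    rw [abs_mul]
    exact mul_le_of_le_one_right (abs_nonneg _) h1
  linarith [neg_abs_le (βp p * Real.cos (u1PlaqAngle inc p θ))]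

/-- **STRICT `(8/9)·ESS` FLOOR FOR THE UNTRAINED U(1) WILSON SAMPLER** (any finite complex, any
couplings): `(8/9)·Z(β)²/((2π)^{n+1}·Z(2β)) < ∫∫ min(p(θ)q, p(θ′)q)`. [ours] -/
theorem u1WilsonIdentityFlow_meanAccept_gt :
    8 / 9 * (u1WilsonZ Ps inc βp ^ 2 / ((2 * π) ^ (n + 1) * u1WilsonZ Ps inc (fun p => 2 * βp p)))
      < ∫ θ in u1TorusBox (n + 1), ∫ θ' in u1TorusBox (n + 1),
          min (u1WilsonWeight Ps inc βp θ / u1WilsonZ Ps inc βp * (1 / (2 * π) ^ (n + 1)))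
            (u1WilsonWeight Ps inc βp θ' / u1WilsonZ Ps inc βp * (1 / (2 * π) ^ (n + 1))) := by
  set μ : Measure (Fin (n + 1) → ℝ) := volume.restrict (u1TorusBox (n + 1)) with hμ
  have hc : (0 : ℝ) < (2 * π) ^ (n + 1) := by positivity
  have hw0 := u1WilsonWeight_pos Ps inc βp
  have hwm : Measurable (u1WilsonWeight Ps inc βp) := (continuous_u1WilsonWeight Ps inc βp).measurable
  have hwi : Integrable (u1WilsonWeight Ps inc βp) μ := integrable_u1WilsonWeight Ps inc βp
  have hq0 : ∀ _θ : Fin (n + 1) → ℝ, (0 : ℝ) < 1 / (2 * π) ^ (n + 1) := fun _ => by positivity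
  have hqm : Measurable fun _ : Fin (n + 1) → ℝ => (1 / (2 * π) ^ (n + 1) : ℝ) := measurable_const
  have hqi : Integrable (fun _ : Fin (n + 1) → ℝ => (1 / (2 * π) ^ (n + 1) : ℝ)) μ := by
    haveI := isFiniteMeasure_volume_restrict_u1TorusBox (n + 1)
    exact integrable_const _
  have hq1 : ∫ _θ, (1 / (2 * π) ^ (n + 1) : ℝ) ∂μ = 1 := integral_u1HaarD
  have hW₂c : Continuous fun θ => u1WilsonWeight Ps inc βp θ / (1 / (2 * π) ^ (n + 1))
      * u1WilsonWeight Ps inc βp θ :=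
    ((continuous_u1WilsonWeight Ps inc βp).div_const _).mul (continuous_u1WilsonWeight Ps inc βp)
  have hW₂ : Integrable (fun θ => u1WilsonWeight Ps inc βp θ / (1 / (2 * π) ^ (n + 1))
      * u1WilsonWeight Ps inc βp θ) μ := integrableOn_u1TorusBox hW₂c
  have hW₂val : ∫ θ, u1WilsonWeight Ps inc βp θ / (1 / (2 * π) ^ (n + 1))
      * u1WilsonWeight Ps inc βp θ ∂μ = (2 * π) ^ (n + 1) * u1WilsonZ Ps inc (fun p => 2 * βp p) := by
    have e : ∀ θ, u1WilsonWeight Ps inc βp θ / (1 / (2 * π) ^ (n + 1)) * u1WilsonWeight Ps inc βp θ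
        = (2 * π) ^ (n + 1) * u1WilsonWeight Ps inc (fun p => 2 * βp p) θ := by
      intro θ
      rw [← u1WilsonWeight_sq]
      field_simp
    simp_rw [e]
    rw [integral_const_mul, hμ, ← u1WilsonZ]
  -- the ratio is bounded below by `(2π)^{n+1} e^{−Σ|β_p|}`
  have ht₀ : 0 < Real.exp (-∑ p ∈ Ps, |βp p|) * (2 * π) ^ (n + 1) := by positivity
  have hb : ∀ θ : Fin (n + 1) → ℝ, Real.exp (-∑ p ∈ Ps, |βp p|) * (2 * π) ^ (n + 1)
      ≤ u1WilsonWeight Ps inc βp θ / (1 / (2 * π) ^ (n + 1)) := fun θ => by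
    rw [div_div_eq_mul_div, div_one]
    exact mul_le_mul_of_nonneg_right (u1WilsonWeight_ge Ps inc βp θ) hc.le
  have h := meanAccept_overlapForm_gt_eight_ninths_ESS (μ := μ) hw0 hwm hwi hq0 hqm hqi hq1 hW₂ ht₀ hb
  have hZdef : ∫ z, u1WilsonWeight Ps inc βp z ∂μ = u1WilsonZ Ps inc βp := by rw [hμ, ← u1WilsonZ]
  rw [hZdef, hW₂val] at h
  calc 8 / 9 * (u1WilsonZ Ps inc βp ^ 2 / ((2 * π) ^ (n + 1) * u1WilsonZ Ps inc (fun p => 2 * βp p)))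
      = 8 * u1WilsonZ Ps inc βp ^ 2 / (9 * ((2 * π) ^ (n + 1) * u1WilsonZ Ps inc (fun p => 2 * βp p))) := by
        ring
    _ < _ := h

end General

/-! ## The periodic `L₁ × L₂` torus at uniform coupling -/

section Torus

variable {L₁ L₂ : ℕ} [NeZero L₁] [NeZero L₂] {n : ℕ}
  (e : Fin 2 × (Fin L₁ × Fin L₂) ≃ Fin (n + 1)) (β : ℝ)

/-- **STRICT FLOOR ON THE TORUS**: for every `β` and `V = L₁L₂`,
`(8/9)·(Σₖ I_{|k|}(β)^V)²/Σₖ I_{|k|}(2β)^V < acc` for the untrained U(1) Wilson sampler of the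
periodic torus. [ours] -/
theorem u1TorusIdentityFlow_meanAccept_gt :
    8 / 9 * ((∑' k : ℤ, besselI k.natAbs β ^ (L₁ * L₂)) ^ 2
        / ∑' k : ℤ, besselI k.natAbs (2 * β) ^ (L₁ * L₂))
      < ∫ θ in u1TorusBox (n + 1), ∫ θ' in u1TorusBox (n + 1),
          min (u1WilsonWeight univ (torusInc e) (fun _ => β) θ
                / u1WilsonZ univ (torusInc e) (fun _ => β) * (1 / (2 * π) ^ (n + 1)))
            (u1WilsonWeight univ (torusInc e) (fun _ => β) θ'
                / u1WilsonZ univ (torusInc e) (fun _ => β) * (1 / (2 * π) ^ (n + 1))) := by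
  have h := u1WilsonIdentityFlow_meanAccept_gt univ (torusInc e) (fun _ => β)
  have hc : (0 : ℝ) < (2 * π) ^ (n + 1) := by positivity
  have hS : ∀ A B : ℝ, ((2 * π) ^ (n + 1) * A) ^ 2 / ((2 * π) ^ (n + 1) * ((2 * π) ^ (n + 1) * B))
      = A ^ 2 / B := fun A B => by
    rw [mul_pow, ← mul_assoc, ← sq, mul_div_mul_left _ _ (pow_ne_zero 2 hc.ne')]
  calc 8 / 9 * ((∑' k : ℤ, besselI k.natAbs β ^ (L₁ * L₂)) ^ 2
          / ∑' k : ℤ, besselI k.natAbs (2 * β) ^ (L₁ * L₂))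
      = 8 / 9 * (u1WilsonZ univ (torusInc e) (fun _ => β) ^ 2
          / ((2 * π) ^ (n + 1) * u1WilsonZ univ (torusInc e) (fun _ => 2 * β))) := by
        rw [torus_u1WilsonZ_uniform e β, torus_u1WilsonZ_uniform e (2 * β), hS]
    _ < _ := h

end Torus

end Summit.Ventures.LatticeQCDFlow.Theory2
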